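import Summits.BirchSwinnertonDyer.BirchSwinnertonDyer.Theorems.PrintX8SmallImageRiderRankZero
import Summits.BirchSwinnertonDyer.Rank1Residual.PrintX8.CertificateClaim
import Literature.NumberTheory.EllipticCurves.Rank1Residual.Typed.SelmerCardCertificateRankZero
import HarnessLib

/-!
# Route `PrintX8`, crux `MuBoundSmallImageX8` (stmt-BirchSwinnertonDyer-20622), ANALYTIC RANK `0`, part 3:
# the small-image X8 pairs with `ord₃ #Ш_an = 2` — the rider's SHARP upper half meets the `3`-descent
# lower half (Cassels–Tate): `BSD(E,3)` PER PAIR with NO Cha / Heegner index, NO Wuthrich, NO K1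
# (cell `bsd-print-x8`, D-0131 (2) print tier, seat p3 gen 2; `--supports` 20622; theorems only)

PARTITION (cell bsd-print-x8, leaf `ClassX8`; 217 census cells, 61 with image `N_ns⁺(3)`): per-pair
and record theorems CONDITIONAL on published named facts + the displayed analytic rider + a displayed
`3`-descent line; closes NONE as a class; 0 census cells move by class theorem; BSD is not proved by
any of this. beyond-print theorem: YES (as part 1: the integral upper half at non-surjective image).

HONEST FRAMING. Part 1 (`PrintX8SmallImageRiderRankZero`, p548892) gives, on X8 ∧ `¬ surj(3)` ∧
`r_an = 0`, the INTEGRAL upper half `ord₃ #Ш ≤ ord₃ #Ш_an` from ONE colour of unit content, and closes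
`BSD(E,3)` when `3 ∤ #Ш_an` (54 of the 61 small-image cells) — reducing the 6 rank-`0` cells with
`3 ∣ #Ш_an` to the LOWER half `MissingLowerBoundAt W 3`. THIS file feeds that lower half from the tree's
certificate shape `3^{2k−1} ∣ #Ш(E/ℚ)` + Cassels–Tate squareness
(`Typed.missingLowerBoundAt_of_casselsTate_of_pow_dvd`, bsd.S18 `exists_casselsTate_pairing` BY NAME),
and for `k = 1` from the native `3`-descent line `Sel^(3)(E/ℚ) ≠ 0` (rank `0` by GZK, `3 ∤ #E(ℚ)_tors`
by `ClassX8.irr'` ⟹ `Ш(E)[3] ≠ 0`, `Typed.exists_sha_torsion_of_selmerGroup_ne_bot`).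

WHY IT MATTERS (census, numbers): of the 6 rank-`0` small-image cells with `3 ∣ #Ш_an`
(ty3 `x8_smallimage_61cells.tsv`), five have `#Ш_an = 9`: 116032by1, 364658br1, 372416dm1, 493790v1
(`ord₃ ∏c_ℓ = 1`) and 474320e1 (`ord₃ ∏c_ℓ = 0`); one has `#Ш_an = 81` (288800cu1). Cell b2b-bsdres
(harvest-1 g23, `Supersingular/ChaDescentRoute.lean` + `HOME/b2b-bsdres-harvest-1/g23/desc3nn/desc3nn_join.tsv`)
certified the LOWER half on all six with TWO `3`-descent engines (`dim_𝔽₃ Sel^(3)(E/ℚ) = 2`, same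
subspace, PARI-free verify PASS) but could close ONLY 474320e1: its upper half there is Cha 2005 (Miller
Thm. 5.2) `ord₃ #Ш ≤ 2·ord₃ [E(K) : ℤ y_K]`, and the Heegner index carries the Tamagawa `3` — verdict
«OPEN (S = 1: index bound 2v = 4 > 2)» for 116032by1 / 364658br1 / 372416dm1, «OPEN (no index field
found)» for 493790v1 (Wuthrich 2014 Prop. 21 and Jetchev's sharpening need `ρ̄_{E,3}` onto). The rider's
upper half of part 1 is SHARP (it bounds `ord₃ #Ш` by `ord₃ #Ш_an = 2` itself, Tamagawa numbers inside
Sprung 2024 Lemma 5.9), so §6 closes `BSD(E,3)` PER PAIR on these FOUR previously open cells (and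
re-closes 474320e1 without Cha), given one certified Mazur–Tate layer and the descent line each.
288800cu1 (`#Ш_an = 81`) needs `27 ∣ #Ш(E/ℚ)` (`k = 2`; a `9`-descent or `dim Ш[3] = 4`) and stays open
per pair. Per-pair tally of the small-image branch after parts 1–3 (modulo PUB + `hCK` + GZK +
Cassels–Tate + per-pair certificates): 54 (`3 ∤ #Ш_an`) + 5 (`#Ш_an = 9`) of the 60 rank-`0` cells;
the rank-`1` cell 478400hc1 is b2b's exact-descent row (`NonsplitCartanThreeDescentRecordsX8Three03`).

## Contents
* §6 `X8.bsdp_of_hasUnitContent_of_casselsTate_of_pow_dvd_…` (general `k`: `ord₃ #Ш_an ≤ 2k`,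
  `3^{2k−1} ∣ #Ш`); `X8.bsdp_of_hasUnitContent_of_casselsTate_of_selmerThree_ne_bot_…` (`k = 1`:
  `ord₃ #Ш_an ≤ 2`, `Sel^(3)(E/ℚ) ≠ 0`); `X8.bsdp_of_mazurTate_of_casselsTate_of_selmerThree_ne_bot_…`
  (the rider from ONE certified Mazur–Tate layer, p3 g1's reading).
* §7 RECORD LEVEL: `certificateRecord_bsdp_of_mazurTate_of_selmerThree_ne_bot_smallImage_rankZero`
  (ty3 `Record.Claim` + `surj3 = false` + `rank = 0` + `padicValNat 3 shaAn ≤ 2` + one layer + the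
  descent line ⟹ `BSDp r.curve 3`).

What is NOT here: the descent computations (b2b's, two engines; they enter as the displayed line
`W.selmerGroup 3 ≠ ⊥`); 288800cu1; any class theorem; anything booked.
References: [Sprung2012] Thm. 7.14, Thm. 7.16 (p. 1504); [Sprung2024] §5.2 Lemmas 5.5–5.9; [SilvermanAEC2009]
Thm. X.4.14 (Cassels–Tate); [Cassels1962]; [Miller2011LMS] Def. 1.1, Thm. 5.2; [Cha2005] (why the four
cells were open); [SchaeferStoll2004] (the descent); tree: part 1, `Typed/CasselsLowerBound.lean`,
`Typed/SelmerCardCertificateRankZero.lean`, `Typed/X10bHeegnerIndexCertificate.lean`,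
`Supersingular/ChaDescentRoute.lean`.
-/

set_option autoImplicit false
-- justification: the mandated namespace `Summit.BirchSwinnertonDyer.BirchSwinnertonDyer.Theorems`
-- (single-conjunct summit, Sub = Summit) repeats a segment by design (D-0017).
set_option linter.dupNamespace false

noncomputable section

open scoped Classical NumberField MatrixGroups ModularForm

open NumberField IsDedekindDomain WeierstrassCurve CongruenceSubgroup Field
  Literature.NumberTheory.EllipticCurves Literature.NumberTheory.EllipticCurves.ModularForms
  Literature.NumberTheory.EllipticCurves.Rank1Residual
  Literature.NumberTheory.EllipticCurves.Rank1Residual.Typed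
  Literature.NumberTheory.EllipticCurves.Sprung2017 Literature.NumberTheory.EllipticCurves.Sprung2012
  Literature.NumberTheory.EllipticCurves.Sprung2024
  Literature.NumberTheory.EllipticCurves.GreenbergVatsal2000
  Literature.NumberTheory.EllipticCurves.ZpExtension
  Summit.BirchSwinnertonDyer.BirchSwinnertonDyer.Theorems
  Summit.BirchSwinnertonDyer.BirchSwinnertonDyer.Theorems.PrintX8SmallImageRiderRankZero
  Summit.BirchSwinnertonDyer.Rank1Residual.Supersingular
  Summit.BirchSwinnertonDyer.Rank1Residual.X1.MuLambda

namespace Summit.BirchSwinnertonDyer.BirchSwinnertonDyer.Theorems.PrintX8SmallImageRiderDescent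

/-! ### §6 PER PAIR, X8 ∧ `ρ̄_{E,3}` NOT onto ∧ `r_an = 0` ∧ `ord₃ #Ш_an ≤ 2k`: rider (upper) + descent (lower) -/

section PerPair

variable (W : WeierstrassCurve ℚ) [W.IsElliptic] [W.IsGloballyMinimal] (p : ℕ) [Fact p.Prime]

/-- **X8 ∧ `¬ surj(3)` ∧ `r_an = 0`, unit-content colour, `ord₃ #Ш_an ≤ 2k`, certificate `3^{2k−1} ∣ #Ш(E/ℚ)`
⟹ `BSD(E,3)`.** Upper half: part 1 (the rider through the reduction-free core; Sprung 2012 Thm. 7.16 made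
integral; Sprung 2024 §5.2); lower half: Cassels–Tate squareness (`hCT`, bsd.S18) turns `3^{2k−1} ∣ #Ш`
into `2k ≤ ord₃ #Ш` (`Typed.missingLowerBoundAt_of_casselsTate_of_pow_dvd`; `Ш` finite by GZK at rank `0`).
Named inputs: `h22`, `h714`, `h716`, `hCK`, `h59`, `h3`, GZK, `hmod`, `hCT`. NO Cha / Heegner index, NO
Wuthrich, NO K1. PER PAIR; conditional; closes nothing. [cite: Sprung2012, Thm. 7.14 and Thm. 7.16 (p. 1504)]
[cite: Sprung2024, §5.2 Lemmas 5.5–5.9] [cite: SilvermanAEC2009, Thm. X.4.14] [cite: Miller2011LMS, §1 and Def. 1.1] -/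
theorem X8.bsdp_of_hasUnitContent_of_casselsTate_of_pow_dvd_of_not_surj_of_analyticRank_eq_zero
    (h22 : thm22_exists_isHondaSystem) (h714 : thm714_sharpFlatSelmerDual_finite_torsion)
    (h716 : thm716_sharpFlatCharIdeal_divisibility) (hCK : thm714seq_sharpFlatColemanKato_zeta)
    (h59 : lem59AllN_sharpFlatCharValue_rankZero) (h3 : realPeriodRat_eq_unit_mul_plusPeriod_three)
    (hGZK : rank_eq_analyticRank_of_analyticRank_le_one) (hmod : hasEntireLFunction_rat)
    (hCT : exists_casselsTate_pairing (K := ℚ))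
    (hX : ClassX8 W p) (hns : ¬ Surj W p) (h0 : W.analyticRank = 0)
    {N : ℕ} [NeZero N] {f : CuspForm (Gamma0 N) 2} (hf : IsNewformOf W f)
    {Lsharp Lflat : IwasawaAlgebra p} (hSP : IsSprungPair f p (W.frobeniusTrace p) Lsharp Lflat)
    (col : Chroma) (hu : HasUnitContent (chromaticL col Lsharp Lflat))
    {k : ℕ} {q : ℚ} (hq : shaAn W = (q : ℂ)) (hv : padicValRat p q ≤ 2 * k)
    (hdvd : p ^ (2 * k - 1) ∣ W.shaOrder) : BSDp W p :=
  X8.bsdp_of_hasUnitContent_of_missingLowerBoundAt_of_not_surj_of_analyticRank_eq_zero W p h22 h714 h716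
    hCK h59 h3 hGZK hmod hX hns h0 hf hSP col hu
    (missingLowerBoundAt_of_casselsTate_of_pow_dvd W p hCT (hGZK W (by omega)).2 hq hv hdvd)

/-- **X8 ∧ `¬ surj(3)` ∧ `r_an = 0`, unit-content colour, `ord₃ #Ш_an ≤ 2`, the native `3`-descent line
`Sel^(3)(E/ℚ) ≠ 0` ⟹ `BSD(E,3)`** (`k = 1`): at rank `0` (GZK) with `3 ∤ #E(ℚ)_tors` (`E[3]` irreducible
on X8, `ClassX8.irr'`) the line IS `Ш(E)[3] ≠ 0` (`Typed.exists_sha_torsion_of_selmerGroup_ne_bot`), so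
`3 ∣ #Ш(E/ℚ)`; then the previous theorem. Census: closes PER PAIR the four `#Ш_an = 9` small-image cells
116032by1, 364658br1, 372416dm1, 493790v1 that b2b g23 left «OPEN» (Cha's index bound `2v = 4 > 2` /
no index field), plus 474320e1, given their two-engine `dim Sel^(3) = 2` lines and one Mazur–Tate layer
each. NO Cha, NO Heegner point, NO Wuthrich, NO K1. PER PAIR; conditional; closes nothing.
[cite: SilvermanAEC2009, Thm. X.4.14] [cite: Miller2011LMS, §1 and Def. 1.1]
[cite: Sprung2012, Thm. 7.16 (p. 1504)] [cite: Sprung2024, §5.2 Lemmas 5.5–5.9] -/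
theorem X8.bsdp_of_hasUnitContent_of_casselsTate_of_selmerThree_ne_bot_of_not_surj_of_analyticRank_eq_zero
    (h22 : thm22_exists_isHondaSystem) (h714 : thm714_sharpFlatSelmerDual_finite_torsion)
    (h716 : thm716_sharpFlatCharIdeal_divisibility) (hCK : thm714seq_sharpFlatColemanKato_zeta)
    (h59 : lem59AllN_sharpFlatCharValue_rankZero) (h3 : realPeriodRat_eq_unit_mul_plusPeriod_three)
    (hGZK : rank_eq_analyticRank_of_analyticRank_le_one) (hmod : hasEntireLFunction_rat)
    (hCT : exists_casselsTate_pairing (K := ℚ))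
    (hX : ClassX8 W p) (hns : ¬ Surj W p) (h0 : W.analyticRank = 0)
    {N : ℕ} [NeZero N] {f : CuspForm (Gamma0 N) 2} (hf : IsNewformOf W f)
    {Lsharp Lflat : IwasawaAlgebra p} (hSP : IsSprungPair f p (W.frobeniusTrace p) Lsharp Lflat)
    (col : Chroma) (hu : HasUnitContent (chromaticL col Lsharp Lflat))
    {q : ℚ} (hq : shaAn W = (q : ℂ)) (hv : padicValRat p q ≤ 2)
    (hSel : W.selmerGroup (p : ℤ) ≠ ⊥) : BSDp W p := by
  have hr1 : W.analyticRank ≤ 1 := by omega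
  have hrank : W.mordellWeilRank = 0 := by rw [(hGZK W hr1).1, h0]
  have hirr : W.HasIrreducibleModPGaloisRep p := ClassX8.irr' W p hX
  have htors : ¬ p ∣ W.torsionOrder := by
    intro hd
    have h0t := padicValNat_torsionOrder_eq_zero_of_irreducible W p hirr
    rw [padicValNat.eq_zero_iff] at h0t
    rcases h0t with h | h | h
    · exact absurd h (Fact.out : p.Prime).one_lt.ne'
    · exact absurd h W.torsionOrder_pos_holds.ne'
    · exact h hd
  have hdvd : p ∣ W.shaOrder :=
    dvd_shaOrder_of_exists_torsion W p (exists_sha_torsion_of_selmerGroup_ne_bot W p hSel hrank htors)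
  exact X8.bsdp_of_hasUnitContent_of_casselsTate_of_pow_dvd_of_not_surj_of_analyticRank_eq_zero W p h22
    h714 h716 hCK h59 h3 hGZK hmod hCT hX hns h0 hf hSP col hu (k := 1) hq (by simpa using hv)
    (by simpa using hdvd)

/-- **The per-cell consumer for the `#Ш_an = 9` small-image cells: ONE certified Mazur–Tate layer
(`ι Θ = θ_n(f)`, `Θ ≠ 0`, `μ(Θ) = 0`) + the `3`-descent line `Sel^(3)(E/ℚ) ≠ 0` + `ord₃ #Ш_an ≤ 2`
⟹ `BSD(E,3)`** on X8 ∧ `¬ surj(3)` ∧ `r_an = 0` (a colour of unit content by p3 g1's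
`PrintX8MazurTateMuRider.ClassX8.exists_chromaticL_muZero_of_mazurTate`). PER PAIR; conditional.
[cite: Pollack2003, Prop. 6.9 and Prop. 6.10] [cite: Sprung2017, §3.1, Cor. 4.4 and Thm. 1.12]
[cite: SilvermanAEC2009, Thm. X.4.14] [cite: Miller2011LMS, §1 and Def. 1.1] -/
theorem X8.bsdp_of_mazurTate_of_casselsTate_of_selmerThree_ne_bot_of_not_surj_of_analyticRank_eq_zero
    (h22 : thm22_exists_isHondaSystem) (h714 : thm714_sharpFlatSelmerDual_finite_torsion)
    (h716 : thm716_sharpFlatCharIdeal_divisibility) (hCK : thm714seq_sharpFlatColemanKato_zeta)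
    (h59 : lem59AllN_sharpFlatCharValue_rankZero) (h3 : realPeriodRat_eq_unit_mul_plusPeriod_three)
    (hGZK : rank_eq_analyticRank_of_analyticRank_le_one) (hmod : hasEntireLFunction_rat)
    (hCT : exists_casselsTate_pairing (K := ℚ))
    (hX : ClassX8 W p) (hns : ¬ Surj W p) (h0 : W.analyticRank = 0)
    {N : ℕ} [NeZero N] {f : CuspForm (Gamma0 N) 2} (hf : IsNewformOf W f)
    {Lsharp Lflat : IwasawaAlgebra p} (hSP : IsSprungPair f p (W.frobeniusTrace p) Lsharp Lflat)
    {n : ℕ} {Θ : IwasawaAlgebra p}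
    (hΘ : iwasawaToPowerSeries p Θ =
      ((mazurTateElement f p n).map (algebraMap ℚ ℚ_[p]) : PowerSeries ℚ_[p]))
    (hΘ0 : Θ ≠ 0) (hμΘ : mu Θ = 0)
    {q : ℚ} (hq : shaAn W = (q : ℂ)) (hv : padicValRat p q ≤ 2)
    (hSel : W.selmerGroup (p : ℤ) ≠ ⊥) : BSDp W p := by
  obtain ⟨col, -, -, hu, -⟩ :=
    PrintX8MazurTateMuRider.ClassX8.exists_chromaticL_muZero_of_mazurTate hX hf hSP hΘ hΘ0 hμΘ
  exact X8.bsdp_of_hasUnitContent_of_casselsTate_of_selmerThree_ne_bot_of_not_surj_of_analyticRank_eq_zero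
    W p h22 h714 h716 hCK h59 h3 hGZK hmod hCT hX hns h0 hf hSP col hu hq hv hSel

end PerPair

/-! ### §7 RECORD LEVEL: ty3's certified records with `ord₃ shaAn ≤ 2` + one layer + the descent line -/

section Records

open Summit.BirchSwinnertonDyer.Rank1Residual.PrintX8

/-- **Record-level consumer for the `#Ш_an = 9` small-image cells.** For a certified census record `r`
(ty3 `Rank1Residual/PrintX8/CertificateRecords*.lean`) whose `Claim` is granted, with `r.surj3 = false`,
`r.rank = 0` and `ord₃ r.shaAn ≤ 2`: ONE certified Mazur–Tate layer of the newform `f` of `r.curve` and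
the `3`-descent line `Sel^(3)(r.curve/ℚ) ≠ 0` give Miller's `BSD(E,3)` for `r.curve` — targets
116032by1, 364658br1, 372416dm1, 474320e1, 493790v1 (b2b g23: two-engine `dim Sel^(3) = 2`). Named
inputs BY NAME: `h22`, `h714`, `h716`, `hCK`, `h59`, `h3`, GZK, `hmod`, Cassels–Tate `hCT`. PER RECORD;
conditional; books nothing. [cite: SilvermanAEC2009, Thm. X.4.14] [cite: Miller2011LMS, §1 and Def. 1.1]
[cite: Sprung2012, Thm. 7.16 (p. 1504)] [cite: Pollack2003, Prop. 6.9 and Prop. 6.10] -/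
theorem certificateRecord_bsdp_of_mazurTate_of_selmerThree_ne_bot_smallImage_rankZero
    (h22 : thm22_exists_isHondaSystem) (h714 : thm714_sharpFlatSelmerDual_finite_torsion)
    (h716 : thm716_sharpFlatCharIdeal_divisibility) (hCK : thm714seq_sharpFlatColemanKato_zeta)
    (h59 : lem59AllN_sharpFlatCharValue_rankZero) (h3 : realPeriodRat_eq_unit_mul_plusPeriod_three)
    (hGZK : rank_eq_analyticRank_of_analyticRank_le_one) (hmod : hasEntireLFunction_rat)
    (hCT : exists_casselsTate_pairing (K := ℚ))
    (r : Record) [r.curve.IsElliptic] [r.curve.IsGloballyMinimal] (h : r.Claim)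
    (hs : r.surj3 = false) (hr : r.rank = 0) (h2 : padicValNat 3 r.shaAn ≤ 2)
    {N : ℕ} [NeZero N] {f : CuspForm (Gamma0 N) 2} (hf : IsNewformOf r.curve f)
    {Lsharp Lflat : IwasawaAlgebra 3} (hSP : IsSprungPair f 3 (r.curve.frobeniusTrace 3) Lsharp Lflat)
    {n : ℕ} {Θ : IwasawaAlgebra 3}
    (hΘ : iwasawaToPowerSeries 3 Θ =
      ((mazurTateElement f 3 n).map (algebraMap ℚ ℚ_[3]) : PowerSeries ℚ_[3]))
    (hΘ0 : Θ ≠ 0) (hμΘ : mu Θ = 0) (hSel : r.curve.selmerGroup (3 : ℤ) ≠ ⊥) : BSDp r.curve 3 := by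
  obtain ⟨hrank, -, -, hsha⟩ := r.invariants_of_claim h
  have h0' : r.curve.analyticRank = 0 := by rw [hrank, hr]
  have hv : padicValRat 3 (r.shaAn : ℚ) ≤ 2 := by
    rw [padicValRat.of_nat]
    exact_mod_cast h2
  exact X8.bsdp_of_mazurTate_of_casselsTate_of_selmerThree_ne_bot_of_not_surj_of_analyticRank_eq_zero
    r.curve 3 h22 h714 h716 hCK h59 h3 hGZK hmod hCT (r.classX8_of_claim h) (r.not_surj_of_claim h hs) h0'
    hf hSP hΘ hΘ0 hμΘ (by rw [hsha]; norm_cast) hv hSel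

end Records

end Summit.BirchSwinnertonDyer.BirchSwinnertonDyer.Theorems.PrintX8SmallImageRiderDescent

end
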